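import Mathlib.AlgebraicGeometry.Fiber
import Mathlib.AlgebraicGeometry.Morphisms.Separated
import Mathlib.AlgebraicGeometry.Morphisms.UniversallyClosed
import Mathlib.AlgebraicGeometry.Morphisms.UniversallyOpen
import HarnessLib

/-!
# The rigidity lemma over a base — [MumfordFogartyKirwan1994, Ch. 6 §1, Prop. 6.1] (reduced-total-space form)

[MumfordFogartyKirwan1994, Ch. 6 §1, Proposition 6.1 (Rigidity lemma), pp. 115–116] (= [MumfordAV1970] §4, rigidity
lemma p. 43, over a base): let `p : X → S` be proper and flat with `H⁰(X_s, 𝒪_{X_s}) = κ(s)` for all `s ∈ S`, with a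
section `ε : S → X`, `S` connected; let `q : Y → S` be any (separated) `S`-scheme and `f : X → Y` an `S`-morphism.
If for ONE point `s₀ ∈ S` the fibre `X_{s₀}` is mapped (set-theoretically) to a single point of `Y`, then
`f = η ∘ p` with `η = f ∘ ε : S → Y` — `f` contracts EVERY fibre and factors through the base.

In print the proof runs through `p_* 𝒪_X = 𝒪_S` universally (cohomology and base change) and so covers non-reduced
`X`.  THIS FILE proves the statement for REDUCED `X`, over an arbitrary preconnected base `S`, with the hypotheses
in the form they are used: `p` universally closed (its underlying map is closed) and universally open (Mathlib:
flat + locally of finite presentation ⇒ `UniversallyOpen.of_flat`), `q` separated, and for every `s` the pull-back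
`κ(s) → Γ(X_s, 𝒪)` surjective (`hH0`; for a non-empty fibre over a field this is `H⁰(X_s, 𝒪) = κ(s)`).  ARGUMENT
(Mumford's, with the reduced-scheme ending of [GortzWedhorn2020] Prop. 9.2 / Mathlib
`ext_of_isDominant_of_isSeparated` replacing `p_* 𝒪_X = 𝒪_S`):
1. (`fiberι_comp_eq_of_forall_mem_affineOpen`) if the fibre `X_s` lands inside an AFFINE open `V ⊆ Y`, then `f` and
   `η ∘ p` agree on the scheme-theoretic fibre `X_s ↪ X`: both restrict to morphisms `X_s → V` into an affine scheme,
   which are determined by global sections (Mathlib `ext_of_isAffine`); every global section of `X_s` is pulled back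
   from `κ(s)` (`hH0`) and is therefore detected by the `κ(s)`-point `ε(s)` of `X_s`, where the two maps agree.
2. (`isOpen_setOf_fiber_subset`) the set of `s` whose fibre lies in a given open of `X` is open (`p` closed).
3. (`rigidity`) the points of `X` where `f` and `η ∘ p` agree as `κ(x)`-points form the support `E` of the equaliser,
   a CLOSED subscheme (`q` separated, Mathlib `isClosedImmersion_equalizer_ι_left`); the set `T` of `s ∈ S` whose
   whole fibre lies in `E` is closed (`p` open) and open (a fibre inside `E` is contracted to the point `η(s)`, which
   has an affine neighbourhood `V`; step 2 gives an open `U ∋ s` of fibres inside `f⁻¹(V)`, step 1 puts them in `E`),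
   and contains `s₀` (step 1 again); `S` preconnected ⇒ `T = S` ⇒ the equaliser is a surjective closed immersion into
   the reduced `X`, i.e. `f = η ∘ p`.

Also: `rigidity_of_flat` (the printed hypotheses: `p` universally closed, flat, locally of finite presentation) and
`exists_eq_comp_of_rigidity` (`∃ η, f = p ≫ η`).  Mathlib-only; theorems only; no named facts.  The tree has the
rigidity THEOREM over a FIELD (★ `Motives.AbelianVarietyRigidity.rigidity`, Milne AV Thm. 2.1) and its corollaries;
over a base this lemma was absent (cell hodgecm-mathlib `B-plan/M1PRIME-DAG.md` §3 N0 «rigidity over `S`» LACKS;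
seat B-p18 (g13)).  It feeds [MumfordFogartyKirwan1994] Cor. 6.4–6.6 (homomorphisms / commutativity / rigidity of
abelian schemes over a connected base) beyond the fibrewise cases.

## References
* [MumfordFogartyKirwan1994] D. Mumford, J. Fogarty, F. Kirwan, *Geometric Invariant Theory*, 3rd ed., Springer 1994,
  Ch. 6 §1, Prop. 6.1 (Rigidity lemma), pp. 115–116; Cor. 6.4–6.6 (p. 117).
* [MumfordAV1970] D. Mumford, *Abelian Varieties*, §4, Rigidity lemma (p. 43) and its proof.
* [GortzWedhorn2020] U. Görtz, T. Wedhorn, *Algebraic Geometry I*, 2nd ed. (2020), Prop. 9.2, Def./Prop. 9.7–9.8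
  (equaliser of morphisms to a separated scheme is a closed subscheme).
-/

noncomputable section

universe u

open CategoryTheory CategoryTheory.Limits AlgebraicGeometry TopologicalSpace

namespace Literature.AlgebraicGeometry.Morphisms

variable {X Y S : Scheme.{u}}

/-! ### §1 Fibres inside an open set -/

/-- For a morphism `p : X → S` whose underlying map is CLOSED and an open `W ⊆ X`, the set of points `s ∈ S` whose
whole fibre `p⁻¹(s)` lies in `W` is open: it is the complement of the closed set `p(X ∖ W)`.  (The topological step of
the rigidity lemma, [MumfordAV1970] §4 proof: «since `p` is a closed map …».) [cite: MumfordAV1970, §4 Rigidity lemma (p. 43), proof] -/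
theorem isOpen_setOf_fiber_subset (p : X ⟶ S) (hp : IsClosedMap p.base) (W : X.Opens) :
    IsOpen {s : S | ∀ x : X, p.base x = s → x ∈ W} := by
  have h : {s : S | ∀ x : X, p.base x = s → x ∈ W} = (p.base '' (W : Set X)ᶜ)ᶜ := by
    ext s
    simp only [Set.mem_setOf_eq, Set.mem_compl_iff, Set.mem_image, not_exists, not_and]
    constructor
    · intro h x hx hxs
      exact hx (h x hxs)
    · intro h x hxs
      by_contra hx
      exact h x hx hxs
  rw [h, isOpen_compl_iff]
  exact hp _ W.2.isClosed_compl

/-! ### §2 A fibre with `H⁰ = κ(s)` mapping into an affine open is contracted -/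

/-- **Key step of the rigidity lemma** ([MumfordAV1970] §4, [MumfordFogartyKirwan1994] Prop. 6.1, proof): let
`p : X → S` with a section `ε`, `f : X → Y` any morphism, and `s ∈ S` a point such that every
global function on the scheme-theoretic fibre `X_s` comes from `κ(s)` (`hs`, i.e. `H⁰(X_s, 𝒪) = κ(s)`) and such that
`f` maps the fibre `p⁻¹(s)` into an AFFINE open `V ⊆ Y`.  Then `f` and `f ∘ ε ∘ p` AGREE ON THE FIBRE `X_s ↪ X`:
both induce morphisms `X_s → V` to an affine scheme, determined by their effect on global sections
(Mathlib `ext_of_isAffine`), and a global section of `X_s`, being pulled back from `Spec κ(s)`, is determined by its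
pull-back along the `κ(s)`-point `ε(s) : Spec κ(s) → X_s`, where the two morphisms coincide.
[cite: MumfordFogartyKirwan1994, Ch. 6 §1 Proposition 6.1 (pp. 115–116), proof] [cite: MumfordAV1970, §4 Rigidity lemma (p. 43), proof] -/
theorem fiberι_comp_eq_of_forall_mem_affineOpen {p : X ⟶ S} (f : X ⟶ Y) (ε : S ⟶ X) (hε : ε ≫ p = 𝟙 S) (s : S)
    (hs : Function.Surjective (p.fiberToSpecResidueField s).appTop.hom)
    {V : Y.Opens} (hV : IsAffineOpen V) (hsV : ∀ x : X, p.base x = s → f.base x ∈ V) :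
    p.fiberι s ≫ f = p.fiberι s ≫ p ≫ ε ≫ f := by
  -- the `κ(s)`-point `ε(s)` of the fibre, a section of `π : X_s → Spec κ(s)`
  let e : Spec (S.residueField s) ⟶ p.fiber s :=
    pullback.lift (S.fromSpecResidueField s ≫ ε) (𝟙 _)
      (by rw [Category.assoc, hε, Category.comp_id, Category.id_comp])
  have he_ι : e ≫ p.fiberι s = S.fromSpecResidueField s ≫ ε := pullback.lift_fst _ _ _
  have he_π : e ≫ p.fiberToSpecResidueField s = 𝟙 _ := pullback.lift_snd _ _ _
  -- points of the fibre lie over `s`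
  have hfib : ∀ x' : ↥(p.fiber s), p.base ((p.fiberι s).base x') = s := fun x' => by
    have hx : (p.fiberι s).base x' ∈ p.base ⁻¹' {s} := by
      rw [← Scheme.Hom.range_fiberι]
      exact ⟨x', rfl⟩
    exact hx
  have hεp : ∀ t : S, p.base (ε.base t) = t := fun t => by
    rw [← Scheme.Hom.comp_apply, hε]
    rfl
  -- the second map factors through `Spec κ(s)`
  have hb : p.fiberι s ≫ p ≫ ε ≫ f = p.fiberToSpecResidueField s ≫ S.fromSpecResidueField s ≫ ε ≫ f := by
    rw [← Category.assoc, Scheme.Hom.fiber_fac, Category.assoc]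
  -- both maps land in `V`
  have ha' : Set.range (p.fiberι s ≫ f).base ⊆ Set.range V.ι.base := by
    rw [Scheme.Opens.range_ι]
    rintro _ ⟨x', rfl⟩
    rw [Scheme.Hom.comp_apply]
    exact hsV _ (hfib x')
  have hb' : Set.range (p.fiberι s ≫ p ≫ ε ≫ f).base ⊆ Set.range V.ι.base := by
    rw [Scheme.Opens.range_ι]
    rintro _ ⟨x', rfl⟩
    rw [Scheme.Hom.comp_apply, Scheme.Hom.comp_apply, Scheme.Hom.comp_apply, hfib x']
    exact hsV _ (hεp s)
  -- lift them to `V`, an affine scheme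
  haveI : IsAffine (V : Scheme.{u}) := hV
  suffices hlift : IsOpenImmersion.lift V.ι _ ha' = IsOpenImmersion.lift V.ι _ hb' by
    rw [← IsOpenImmersion.lift_fac V.ι _ ha', ← IsOpenImmersion.lift_fac V.ι _ hb', hlift]
  -- the lifts agree after the point `e`
  have key : e ≫ IsOpenImmersion.lift V.ι _ ha' = e ≫ IsOpenImmersion.lift V.ι _ hb' := by
    rw [← cancel_mono V.ι, Category.assoc, Category.assoc, IsOpenImmersion.lift_fac, IsOpenImmersion.lift_fac,
      hb, ← Category.assoc e (p.fiberToSpecResidueField s), he_π, Category.id_comp,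
      ← Category.assoc e (p.fiberι s), he_ι, Category.assoc]
  -- `e^* ∘ π^* = id` on global sections
  have hret : ∀ l, e.appTop.hom ((p.fiberToSpecResidueField s).appTop.hom l) = l := fun l => by
    rw [← CommRingCat.comp_apply, ← Scheme.Hom.comp_appTop, he_π, Scheme.Hom.id_appTop]
    rfl
  refine ext_of_isAffine (CommRingCat.hom_ext (RingHom.ext fun r => ?_))
  obtain ⟨l₁, hl₁⟩ := hs ((IsOpenImmersion.lift V.ι _ ha').appTop.hom r)
  obtain ⟨l₂, hl₂⟩ := hs ((IsOpenImmersion.lift V.ι _ hb').appTop.hom r)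
  have heq := congrArg (fun φ => φ.appTop.hom r) key
  simp only [Scheme.Hom.comp_appTop, CommRingCat.hom_comp, RingHom.comp_apply] at heq
  have hl : l₁ = l₂ := by
    rw [← hret l₁, ← hret l₂, hl₁, hl₂]
    exact heq
  rw [← hl₁, ← hl₂, hl]

/-! ### §3 The rigidity lemma -/

/-- **RIGIDITY LEMMA OVER A BASE** ([MumfordFogartyKirwan1994] Ch. 6 §1 Prop. 6.1; [MumfordAV1970] §4), for a
reduced total space.  Let `p : X → S` be universally closed and universally open (e.g. proper and flat of finite
presentation), `X` reduced, with a section `ε : S → X` and `H⁰(X_s, 𝒪_{X_s}) = κ(s)` for every `s ∈ S` (in the form: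
`κ(s) → Γ(X_s, 𝒪)` is onto), and let `S` be (pre)connected.  Let `q : Y → S` be separated and `f : X → Y` an
`S`-morphism which maps the fibre over ONE point `s₀` to a single point `y₀ ∈ Y`.  Then `f = (f ∘ ε) ∘ p`: `f`
factors through the base, contracting every fibre.
[cite: MumfordFogartyKirwan1994, Ch. 6 §1 Proposition 6.1 (Rigidity lemma) (pp. 115–116)] [cite: MumfordAV1970, §4 Rigidity lemma (p. 43)] -/
theorem rigidity [IsReduced X] {p : X ⟶ S} {q : Y ⟶ S} [UniversallyClosed p] [UniversallyOpen p]
    [IsSeparated q] [PreconnectedSpace S] (f : X ⟶ Y) (hf : f ≫ q = p) (ε : S ⟶ X) (hε : ε ≫ p = 𝟙 S)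
    (hH0 : ∀ s : S, Function.Surjective (p.fiberToSpecResidueField s).appTop.hom)
    {s₀ : S} {y₀ : Y} (h₀ : ∀ x : X, p.base x = s₀ → f.base x = y₀) :
    f = p ≫ ε ≫ f := by
  have hg : (p ≫ ε ≫ f) ≫ q = p := by
    rw [Category.assoc, Category.assoc, hf, hε, Category.comp_id]
  have hεp : ∀ t : S, p.base (ε.base t) = t := fun t => by
    rw [← Scheme.Hom.comp_apply, hε]
    rfl
  -- the equaliser of `f` and `p ≫ ε ≫ f` in `Over S`: a closed subscheme of `X` since `q` is separated
  let X' : Over S := Over.mk p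
  let Y' : Over S := Over.mk q
  let f' : X' ⟶ Y' := Over.homMk f hf
  let g' : X' ⟶ Y' := Over.homMk (p ≫ ε ≫ f) hg
  haveI : IsSeparated Y'.hom := ‹IsSeparated q›
  let ι : (equalizer f' g').left ⟶ X := (equalizer.ι f' g').left
  have hι : ι ≫ f = ι ≫ p ≫ ε ≫ f := congrArg CommaMorphism.left (equalizer.condition f' g')
  haveI : IsClosedImmersion ι := isClosedImmersion_equalizer_ι_left f' g'
  let E : Set X := Set.range ι.base
  have hEc : IsClosed E := ι.isClosedEmbedding.isClosed_range
  -- (b) if `f` and `p ≫ ε ≫ f` agree on the scheme-theoretic fibre over `u`, the fibre lies in `E`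
  have hb : ∀ u : S, p.fiberι u ≫ f = p.fiberι u ≫ p ≫ ε ≫ f → ∀ x : X, p.base x = u → x ∈ E := by
    intro u hu x hx
    obtain ⟨x', rfl⟩ : x ∈ Set.range (p.fiberι u).base := by
      rw [Scheme.Hom.range_fiberι]
      exact hx
    let t : Over.mk (p.fiberι u ≫ p) ⟶ X' := Over.homMk (p.fiberι u) rfl
    have ht : t ≫ f' = t ≫ g' := by
      ext : 1
      exact hu
    refine ⟨(equalizer.lift t ht).left.base x', ?_⟩
    rw [← Scheme.Hom.comp_apply]
    change (equalizer.lift t ht ≫ equalizer.ι f' g').left.base x' = _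
    rw [equalizer.lift_ι]
    rfl
  -- points of `E` have `f x = f (ε (p x))`
  have hpt : ∀ x ∈ E, f.base x = f.base (ε.base (p.base x)) := by
    rintro _ ⟨y, rfl⟩
    rw [← Scheme.Hom.comp_apply, ← Scheme.Hom.comp_apply, ← Scheme.Hom.comp_apply, ← Scheme.Hom.comp_apply, hι]
  -- (K) a fibre over `u` mapped into an affine open lies in `E`
  have hK : ∀ u : S, (∃ V : Y.Opens, IsAffineOpen V ∧ ∀ x : X, p.base x = u → f.base x ∈ V) →
      ∀ x : X, p.base x = u → x ∈ E := by
    rintro u ⟨V, hV, huV⟩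
    exact hb u (fiberι_comp_eq_of_forall_mem_affineOpen f ε hε u (hH0 u) hV huV)
  -- the set `T` of base points whose whole fibre lies in `E`
  let T : Set S := {s : S | ∀ x : X, p.base x = s → x ∈ E}
  -- a set-theoretically contracted fibre has a neighbourhood inside `T`
  have hnbhd : ∀ (s : S) (y : Y), (∀ x : X, p.base x = s → f.base x = y) →
      ∃ U : Set S, IsOpen U ∧ s ∈ U ∧ U ⊆ T := by
    intro s y hy
    obtain ⟨V, hV, hyV, -⟩ := exists_isAffineOpen_mem_and_subset (X := Y) (x := y) (U := ⊤) trivial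
    refine ⟨{u : S | ∀ x : X, p.base x = u → x ∈ f ⁻¹ᵁ V}, isOpen_setOf_fiber_subset p p.isClosedMap (f ⁻¹ᵁ V),
      fun x hx => ?_, fun u hu => hK u ⟨V, hV, hu⟩⟩
    show f.base x ∈ V
    rw [hy x hx]
    exact hyV
  -- `T` is closed (`p` is open) and open
  have hTc : IsClosed T := by
    have hT : T = (p.base '' Eᶜ)ᶜ := by
      ext s
      simp only [T, Set.mem_setOf_eq, Set.mem_compl_iff, Set.mem_image, not_exists, not_and]
      constructor
      · intro h x hx hxs
        exact hx (h x hxs)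
      · intro h x hxs
        by_contra hx
        exact h x hx hxs
    rw [hT, ← isOpen_compl_iff, compl_compl]
    exact p.isOpenMap _ hEc.isOpen_compl
  have hTo : IsOpen T := by
    rw [isOpen_iff_forall_mem_open]
    intro s hs
    obtain ⟨U, hU, hsU, hUT⟩ := hnbhd s (f.base (ε.base s)) fun x hx => by rw [hpt x (hs x hx), hx]
    exact ⟨U, hUT, hU, hsU⟩
  -- `s₀ ∈ T`, so `T = S`
  have hs₀ : s₀ ∈ T := by
    obtain ⟨U, -, hsU, hUT⟩ := hnbhd s₀ y₀ h₀
    exact hUT hsU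
  have hT : T = Set.univ := IsClopen.eq_univ ⟨hTc, hTo⟩ ⟨s₀, hs₀⟩
  have hE : Function.Surjective ι.base := fun x => by
    have hx : p.base x ∈ T := by
      rw [hT]
      exact Set.mem_univ _
    exact hx x rfl
  -- the equaliser is a surjective closed subscheme of the reduced `X`: `f = p ≫ ε ≫ f`
  haveI : IsDominant ι := ⟨hE.denseRange⟩
  exact ext_of_isDominant_of_isSeparated q (hf.trans hg.symm) ι hι

/-- **Rigidity lemma, printed hypotheses**: `p` universally closed, FLAT and locally of finite presentation (hence
universally open, Mathlib `UniversallyOpen.of_flat`) — e.g. `p` proper and smooth, as for an abelian scheme — with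
reduced total space, a section, `H⁰(X_s, 𝒪) = κ(s)`, connected base; an `S`-morphism to a separated `S`-scheme
contracting one fibre factors through the base. [cite: MumfordFogartyKirwan1994, Ch. 6 §1 Proposition 6.1 (Rigidity lemma) (pp. 115–116)] -/
theorem rigidity_of_flat [IsReduced X] {p : X ⟶ S} {q : Y ⟶ S} [UniversallyClosed p] [Flat p]
    [LocallyOfFinitePresentation p] [IsSeparated q] [PreconnectedSpace S] (f : X ⟶ Y) (hf : f ≫ q = p)
    (ε : S ⟶ X) (hε : ε ≫ p = 𝟙 S)
    (hH0 : ∀ s : S, Function.Surjective (p.fiberToSpecResidueField s).appTop.hom)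
    {s₀ : S} {y₀ : Y} (h₀ : ∀ x : X, p.base x = s₀ → f.base x = y₀) :
    f = p ≫ ε ≫ f :=
  rigidity f hf ε hε hH0 h₀

/-- **Rigidity lemma, factorisation form**: under the hypotheses of `rigidity`, `f` factors through the base —
`f = η ∘ p` for an `S`-section `η : S → Y` of `q` (namely `η = f ∘ ε`). [cite: MumfordFogartyKirwan1994, Ch. 6 §1 Proposition 6.1 (Rigidity lemma) (pp. 115–116)] -/
theorem exists_eq_comp_of_rigidity [IsReduced X] {p : X ⟶ S} {q : Y ⟶ S} [UniversallyClosed p]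
    [UniversallyOpen p] [IsSeparated q] [PreconnectedSpace S] (f : X ⟶ Y) (hf : f ≫ q = p) (ε : S ⟶ X)
    (hε : ε ≫ p = 𝟙 S) (hH0 : ∀ s : S, Function.Surjective (p.fiberToSpecResidueField s).appTop.hom)
    {s₀ : S} {y₀ : Y} (h₀ : ∀ x : X, p.base x = s₀ → f.base x = y₀) :
    ∃ η : S ⟶ Y, η ≫ q = 𝟙 S ∧ f = p ≫ η :=
  ⟨ε ≫ f, by rw [Category.assoc, hf, hε], rigidity f hf ε hε hH0 h₀⟩

/-- **All fibres are contracted** (set-theoretic corollary of `rigidity`): under its hypotheses, `f` is constant on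
every fibre of `p`, with value `f (ε s)` on `p⁻¹(s)`. [cite: MumfordAV1970, §4 Rigidity lemma (p. 43)] -/
theorem apply_eq_apply_section_of_rigidity [IsReduced X] {p : X ⟶ S} {q : Y ⟶ S} [UniversallyClosed p]
    [UniversallyOpen p] [IsSeparated q] [PreconnectedSpace S] (f : X ⟶ Y) (hf : f ≫ q = p) (ε : S ⟶ X)
    (hε : ε ≫ p = 𝟙 S) (hH0 : ∀ s : S, Function.Surjective (p.fiberToSpecResidueField s).appTop.hom)
    {s₀ : S} {y₀ : Y} (h₀ : ∀ x : X, p.base x = s₀ → f.base x = y₀) (x : X) :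
    f.base x = f.base (ε.base (p.base x)) := by
  conv_lhs => rw [rigidity f hf ε hε hH0 h₀]
  rw [Scheme.Hom.comp_apply, Scheme.Hom.comp_apply]

end Literature.AlgebraicGeometry.Morphisms

end
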